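import Summits.QuantumFields.YangMills.Theorems.IR.Negative.TypShellCondFalseAllG

/-!
# Crux `IR` (stmt-QuantumFields-19354) — HAIRPIN STOKES for the layer comb, and the row-floor stub R1d′ PROVED
(companion workfile of `Cruxes/IR/CruxIdea2RowFloorPoly.lean`, seat `ym-cruxidea-19354-2` GEN 7)

The row-floor workfile `CruxIdea2RowFloorPoly.lean` (rev 13, at the 200 kB workfile cap) reduces its ONE stub R1d
`refAction_le_weighted` — after `topFace_energy_comb_le` — to a bound on the HAIRPIN holonomy
`W_j(x) = stair(x) · σ(x,j) · stair(x + e_j)⁻¹` of the staircase transport `FixedMeshAllG.stair`: for a FLAT `σ` the tree's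
`FixedMeshAllG.stair_add_single_of_flatZd` gives `W_j(x) = 1`; here, for an ARBITRARY `σ`, the Frobenius deviation
`‖ρ(W_j(x)) − 1‖` is bounded by the sum of the plaquette deviations `‖ρ(σ_q) − 1‖` over the `≤ combLen R x 2 + combLen R x 3`
plaquettes of the one or two staircase strips swept when the endpoint moves from `x` to `x + e_j` (quantitative non-abelian
Stokes for thin strips).  Self-contained (imports Theorems modules only); all statements are about tree declarations
(`zline`, `stair`, `combPt2`, `combPt3`, `combLen`, `plaquetteHolonomyZd`), so the row-floor workfile's `hairpin b R σ x j`
is `stair b R σ x * σ (x, j) * (stair b R σ (x + Pi.single j 1))⁻¹` by `rfl`.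

* `slideLoop ζ μ ν n y := ζ(y,μ) · zline ζ ν n (y+e_μ) · ζ(y + n e_ν, μ)⁻¹ · (zline ζ ν n y)⁻¹` — the boundary holonomy of the
  thin `1 × n` strip in the `(μ, ν)` plane based at `y`; `slideLoop_succ` (peel the first plaquette:
  `L(n+1, y) = Hol(y, μ, ν) · ζ(y,ν) L(n, y+e_ν) ζ(y,ν)⁻¹`); `norm_map_slideLoop_sub_one_le` (`‖ρ L − 1‖ ≤ Σ_{k<n} ‖ρ Hol(y + k e_ν, μ, ν) − 1‖`,
  unitary `ρ`);
* `stair_add_single_two_eq` ∕ `stair_add_single_one_eq` — the NON-FLAT versions of the tree's `stair_add_single_two/one`: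
  `stair(x + e_2) = Z₁Z₂ · L₃ · Z₃ · σ(x,2)` and `stair(x + e_1) = Z₁ · L₂ · Z₂ · L₃' · Z₃ · σ(x,1)` with explicit slide loops;
* `norm_map_hairpin_three` (`= 0`), `norm_map_hairpin_two_le`, `norm_map_hairpin_one_le`, the uniform
  `norm_map_hairpin_sub_one_le` (every layer direction `j ≠ 0`), its Cauchy–Schwarz square `norm_map_hairpin_sub_one_sq_le`
  (the form R1d consumes: plaquette energies are `‖ρ(σ_q) − 1‖²/2`), and `combLen_le` (`x l ≤ R ⇒ combLen R x l ≤ 2R`: a hairpin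
  sweeps `≤ 4R` layer plaquettes).

STATUS (rev 3, seat `ym-cruxidea-19354-2` GEN 7): `lean check` rc 0, NO `sorry`, no warnings.  **Rev 3 PROVES R1d′ =
`twistAction_le_weighted`** (§ Assembly): for unitary `ρ` and every `n, k₀` there is `C > 0` with, for every `b ≥ 1`, a fixed
weighted plaquette family `(P, w)`, `w ≥ 0`, `Σ_P w ≤ C b⁵`, such that for EVERY `σ`
`wilsonBoundaryAction ρ (rowRegion b n) (twistΦ b (comb b ((2n+2)b+1) k₀) σ) ≤ Σ_{q ∈ P} w q · (N − plaquetteObs ρ q σ)` — which is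
the row-floor file's ONE stub R1d `CruxIdea2g7.refAction_le_weighted` VERBATIM after its own `rw [refConfig_eq_twistΦ]`; i.e. the
polynomial row floor `RowFloorPoly ρ n ε δ (1/7)` is now kernel-complete modulo one import (see IMPORT NOTE).  Ingredients of rev 3:
copies of the row-floor file's §4m plaquette-case lemmas (`energy_topTwist_of_not_topFace`, `topFace_energy_comb_le`, …), the
hairpin Stokes of rev 1, the counts of rev 2 + `bigBox`/`card_touching_rowRegion_le` (`#plaquettesTouching Λ ≤ 6(b+1)((4n+1)b+1)³`),
the coefficient bookkeeping `coef`/`sum_coef_mul`/`sum_coef_le` (per plaquette: mass `2`, plus `≤ 128 R²` on the top face), and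
`C = 24(4n+2)³ + 768(4n+2)³(2n+3)²`.  Rev 2 added the TOP-FACE COUNT
(`box_of_mem_rowRegion`, `topBox`, `card_topBox`, `mem_topBox_of_touching`, `card_touching_height_eq_le`, `card_orientations`):
the plaquettes touching `Λ = rowRegion b n` with base point at height `b` number `≤ 6·((4n+1)b+1)³`.  (Historical, rev 1:) with the hairpin Stokes the residual content
of the row-floor stub R1d `CruxIdea2g7.refAction_le_weighted` was pure COUNTING + ASSEMBLY — now done in § Assembly: split `plaquettesTouching (rowRegion b n)`
by the top-face predicate `q.2.1.1 = 0 ∧ q.1 0 = b` (`CruxIdea2g7.energy_topTwist_of_not_topFace` ∕ `topFace_energy_comb_le`),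
insert `norm_map_hairpin_sub_one_sq_le` (at the layer point `x + e₀`, `InLayer` from `rowRegion` membership, `R = (2n+2)b+1`),
and count: `#plaquettesTouching Λ ≤ C(n) b⁴` (`CruxIdea2g7.rowRegion_counts`) and the top-face count of rev 2 (`≤ 6((4n+1)b+1)³`),
which with the per-hairpin weight `16 (n₃² + n₂²) ≤ 128 R²` gives total weight `≤ C b⁵`.  IMPORT NOTE: crux workfiles cannot import
each other, and `CruxIdea2RowFloorPoly.lean` is at the size cap — the intended path is that the `Negative/` lane owner re-homes THIS
sorry-free file under `Theorems/IR/Negative/…` (as was done for GEN 6's workfile), after which R1d closes inside the row-floor file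
by the four lines `obtain ⟨C, hC, h⟩ := CruxIdea2g7Hairpin.twistAction_le_weighted ρ hρu n k₀; refine ⟨C, hC, fun b hb => ?_⟩;
obtain ⟨P, w, hw, hs, hd⟩ := h b hb; exact ⟨P, w, hw, hs, fun σ => by rw [refConfig_eq_twistΦ]; exact hd σ⟩`.  Negative-side knowledge for stmt-QuantumFields-19354;
closes no registered stub; count-neutral.
-/

set_option autoImplicit false

noncomputable section

open Literature.MathematicalPhysics.QuantumLattice
open Literature.Probability.LatticeModels
open Summit.QuantumFields.YangMills.Cruxes.IR.FixedMeshAllG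

namespace Summit.QuantumFields.YangMills.Cruxes.IR.CruxIdea2g7Hairpin

section Algebra

variable {G : Type} [Group G]

/-- The boundary holonomy of the thin `1 × n` strip in the `(μ, ν)` plane based at `y`:
up `μ`, along `ν` for `n` steps, down `μ`, back along `ν`. -/
def slideLoop (ζ : LGConfig 4 G) (μ ν : Fin 4) (n : ℕ) (y : Site 4) : G :=
  ζ (y, μ) * zline ζ ν n (y + Pi.single μ 1) * (ζ (y + Pi.single ν (n : ℤ), μ))⁻¹ * (zline ζ ν n y)⁻¹

theorem slideLoop_zero (ζ : LGConfig 4 G) (μ ν : Fin 4) (y : Site 4) : slideLoop ζ μ ν 0 y = 1 := by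
  simp [slideLoop]

/-- Peeling the first plaquette off the strip. -/
theorem slideLoop_succ (ζ : LGConfig 4 G) (μ ν : Fin 4) (n : ℕ) (y : Site 4) :
    slideLoop ζ μ ν (n + 1) y =
      plaquetteHolonomyZd ζ y μ ν * (ζ (y, ν) * slideLoop ζ μ ν n (y + Pi.single ν 1) * (ζ (y, ν))⁻¹) := by
  simp only [slideLoop, plaquetteHolonomyZd, zline_succ]
  rw [show y + Pi.single μ (1 : ℤ) + Pi.single ν 1 = y + Pi.single ν 1 + Pi.single μ 1 from add_right_comm _ _ _,
    show y + Pi.single ν (1 : ℤ) + Pi.single ν (n : ℤ) = y + Pi.single ν ((n + 1 : ℕ) : ℤ) by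
      rw [add_assoc, single_add_nat]]
  group

/-- The SLIDE IDENTITY for an arbitrary configuration (the tree's `mul_zline_eq_of_flatZd` has `slideLoop = 1`). -/
theorem mul_zline_eq_slideLoop (ζ : LGConfig 4 G) (μ ν : Fin 4) (n : ℕ) (y : Site 4) :
    ζ (y, μ) * zline ζ ν n (y + Pi.single μ 1) =
      slideLoop ζ μ ν n y * zline ζ ν n y * ζ (y + Pi.single ν (n : ℤ), μ) := by
  simp only [slideLoop]
  group

/-- Direction 3: pure extension of the last segment — the hairpin is trivial (tree `stair_add_single_three`). -/
theorem hairpin_three (ζ : LGConfig 4 G) {b R : ℕ} {x : Site 4} (hx : InLayer b R x) :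
    stair b R ζ x * ζ (x, 3) * (stair b R ζ (x + Pi.single 3 1))⁻¹ = 1 := by
  rw [stair_add_single_three ζ hx]
  group

/-- Direction 2, NON-FLAT: `stair(x + e_2) = Z₁ Z₂ · L · Z₃ · σ(x, 2)` with the slide loop `L` of the last segment. -/
theorem stair_add_single_two_eq (ζ : LGConfig 4 G) {b R : ℕ} {x : Site 4} (hx : InLayer b R x) :
    stair b R ζ (x + Pi.single 2 1) =
      zline ζ 1 (combLen R x 1) (combRoot b R) * zline ζ 2 (combLen R x 2) (combPt2 b R x) *
        slideLoop ζ 2 3 (combLen R x 3) (combPt3 b R x) * zline ζ 3 (combLen R x 3) (combPt3 b R x) * ζ (x, 2) := by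
  have hx3 := combPt3_add_eq hx
  have e1 : combLen R (x + Pi.single 2 1) 1 = combLen R x 1 := combLen_add_single_of_ne x (by decide)
  have e3 : combLen R (x + Pi.single 2 1) 3 = combLen R x 3 := combLen_add_single_of_ne x (by decide)
  have e2 : combLen R (x + Pi.single 2 1) 2 = combLen R x 2 + 1 := combLen_add_single_self (hx.2 2 (by decide))
  have p2 : combPt2 b R (x + Pi.single 2 1) = combPt2 b R x := by simp only [combPt2, e1]
  have p3 : combPt3 b R (x + Pi.single 2 1) = combPt3 b R x + Pi.single 2 1 := by
    simp only [combPt3, p2, e2, single_natCast_succ, add_assoc]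
  have s3 := mul_zline_eq_slideLoop ζ 2 3 (combLen R x 3) (combPt3 b R x)
  rw [hx3] at s3
  have hp3 : combPt2 b R x + Pi.single 2 (combLen R x 2 : ℤ) = combPt3 b R x := rfl
  unfold stair
  rw [e1, e2, e3, p2, p3, zline_succ_right, hp3]
  calc zline ζ 1 (combLen R x 1) (combRoot b R) * (zline ζ 2 (combLen R x 2) (combPt2 b R x) * ζ (combPt3 b R x, 2)) *
        zline ζ 3 (combLen R x 3) (combPt3 b R x + Pi.single 2 1)
      = zline ζ 1 (combLen R x 1) (combRoot b R) * zline ζ 2 (combLen R x 2) (combPt2 b R x) *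
        (ζ (combPt3 b R x, 2) * zline ζ 3 (combLen R x 3) (combPt3 b R x + Pi.single 2 1)) := by group
    _ = _ := by rw [s3]; group

/-- Direction 1, NON-FLAT: two slide loops (segments 2 and 3). -/
theorem stair_add_single_one_eq (ζ : LGConfig 4 G) {b R : ℕ} {x : Site 4} (hx : InLayer b R x) :
    stair b R ζ (x + Pi.single 1 1) =
      zline ζ 1 (combLen R x 1) (combRoot b R) *
        slideLoop ζ 1 2 (combLen R x 2) (combPt2 b R x) * zline ζ 2 (combLen R x 2) (combPt2 b R x) *
        slideLoop ζ 1 3 (combLen R x 3) (combPt3 b R x) * zline ζ 3 (combLen R x 3) (combPt3 b R x) * ζ (x, 1) := by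
  have hx3 := combPt3_add_eq hx
  have e2 : combLen R (x + Pi.single 1 1) 2 = combLen R x 2 := combLen_add_single_of_ne x (by decide)
  have e3 : combLen R (x + Pi.single 1 1) 3 = combLen R x 3 := combLen_add_single_of_ne x (by decide)
  have e1 : combLen R (x + Pi.single 1 1) 1 = combLen R x 1 + 1 := combLen_add_single_self (hx.2 1 (by decide))
  have p2 : combPt2 b R (x + Pi.single 1 1) = combPt2 b R x + Pi.single 1 1 := by
    simp only [combPt2, e1, single_natCast_succ, add_assoc]
  have p3 : combPt3 b R (x + Pi.single 1 1) = combPt3 b R x + Pi.single 1 1 := by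
    simp only [combPt3, p2, e2]; rw [add_right_comm]
  have s2 := mul_zline_eq_slideLoop ζ 1 2 (combLen R x 2) (combPt2 b R x)
  have s3 := mul_zline_eq_slideLoop ζ 1 3 (combLen R x 3) (combPt3 b R x)
  rw [hx3] at s3
  have hp2 : combRoot b R + Pi.single 1 (combLen R x 1 : ℤ) = combPt2 b R x := rfl
  have hp3 : combPt2 b R x + Pi.single 2 (combLen R x 2 : ℤ) = combPt3 b R x := rfl
  rw [hp3] at s2
  unfold stair
  rw [e1, e2, e3, p2, p3, zline_succ_right, hp2]
  calc zline ζ 1 (combLen R x 1) (combRoot b R) * ζ (combPt2 b R x, 1) *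
        zline ζ 2 (combLen R x 2) (combPt2 b R x + Pi.single 1 1) *
        zline ζ 3 (combLen R x 3) (combPt3 b R x + Pi.single 1 1)
      = zline ζ 1 (combLen R x 1) (combRoot b R) * (ζ (combPt2 b R x, 1) *
        zline ζ 2 (combLen R x 2) (combPt2 b R x + Pi.single 1 1)) *
        zline ζ 3 (combLen R x 3) (combPt3 b R x + Pi.single 1 1) := by group
    _ = zline ζ 1 (combLen R x 1) (combRoot b R) * slideLoop ζ 1 2 (combLen R x 2) (combPt2 b R x) *
        zline ζ 2 (combLen R x 2) (combPt2 b R x) *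
        (ζ (combPt3 b R x, 1) * zline ζ 3 (combLen R x 3) (combPt3 b R x + Pi.single 1 1)) := by
        rw [s2]; group
    _ = _ := by rw [s3]; group

/-- The hairpin in direction 2 is a conjugate of the inverse slide loop. -/
theorem hairpin_two_eq (ζ : LGConfig 4 G) {b R : ℕ} {x : Site 4} (hx : InLayer b R x) :
    stair b R ζ x * ζ (x, 2) * (stair b R ζ (x + Pi.single 2 1))⁻¹ =
      (zline ζ 1 (combLen R x 1) (combRoot b R) * zline ζ 2 (combLen R x 2) (combPt2 b R x)) *
        (slideLoop ζ 2 3 (combLen R x 3) (combPt3 b R x))⁻¹ *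
        (zline ζ 1 (combLen R x 1) (combRoot b R) * zline ζ 2 (combLen R x 2) (combPt2 b R x))⁻¹ := by
  rw [stair_add_single_two_eq ζ hx]
  unfold stair
  group

/-- The hairpin in direction 1 is a product of two conjugated inverse slide loops. -/
theorem hairpin_one_eq (ζ : LGConfig 4 G) {b R : ℕ} {x : Site 4} (hx : InLayer b R x) :
    stair b R ζ x * ζ (x, 1) * (stair b R ζ (x + Pi.single 1 1))⁻¹ =
      ((zline ζ 1 (combLen R x 1) (combRoot b R) * zline ζ 2 (combLen R x 2) (combPt2 b R x)) *
          (slideLoop ζ 1 3 (combLen R x 3) (combPt3 b R x))⁻¹ *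
          (zline ζ 1 (combLen R x 1) (combRoot b R) * zline ζ 2 (combLen R x 2) (combPt2 b R x))⁻¹) *
        (zline ζ 1 (combLen R x 1) (combRoot b R) * (slideLoop ζ 1 2 (combLen R x 2) (combPt2 b R x))⁻¹ *
          (zline ζ 1 (combLen R x 1) (combRoot b R))⁻¹) := by
  rw [stair_add_single_one_eq ζ hx]
  unfold stair
  group

end Algebra

section Frobenius

open scoped Matrix Matrix.Norms.Frobenius

variable {G : Type} [Group G] {N : ℕ} (ρ : G →* Matrix (Fin N) (Fin N) ℂ)

theorem norm_map_mul_sub_one_le (hρu : ∀ g, ρ g ∈ Matrix.unitaryGroup (Fin N) ℂ) (g h : G) :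
    ‖ρ (g * h) - 1‖ ≤ ‖ρ g - 1‖ + ‖ρ h - 1‖ := by
  have hsplit : ρ (g * h) - 1 = ρ g * (ρ h - 1) + (ρ g - 1) := by rw [map_mul]; noncomm_ring
  rw [hsplit]
  refine (norm_add_le _ _).trans ?_
  rw [Matrix.frobenius_norm_unitaryGroup_mul ⟨ρ g, hρu g⟩ (ρ h - 1)]
  linarith

theorem norm_map_inv_sub_one (hρu : ∀ g, ρ g ∈ Matrix.unitaryGroup (Fin N) ℂ) (g : G) :
    ‖ρ g⁻¹ - 1‖ = ‖ρ g - 1‖ := by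
  have h : ρ g⁻¹ - 1 = ρ g⁻¹ * (1 - ρ g) := by
    rw [mul_sub, mul_one, ← map_mul, inv_mul_cancel, map_one]
  rw [h, Matrix.frobenius_norm_unitaryGroup_mul ⟨ρ g⁻¹, hρu g⁻¹⟩, norm_sub_rev]

theorem norm_map_conj_sub_one (hρu : ∀ g, ρ g ∈ Matrix.unitaryGroup (Fin N) ℂ) (k g : G) :
    ‖ρ (k * g * k⁻¹) - 1‖ = ‖ρ g - 1‖ := by
  have h : ρ (k * g * k⁻¹) - 1 = ρ k * (ρ g - 1) * ρ k⁻¹ := by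
    rw [map_mul, map_mul, mul_sub, sub_mul, mul_one, mul_assoc (ρ k) (ρ g), ← map_mul, ← map_mul,
      ← map_mul, mul_inv_cancel, map_one]
  rw [h, Matrix.frobenius_norm_mul_unitaryGroup _ ⟨ρ k⁻¹, hρu k⁻¹⟩,
    Matrix.frobenius_norm_unitaryGroup_mul ⟨ρ k, hρu k⟩]

/-- **QUANTITATIVE STRIP STOKES for the slide loop**: `‖ρ L(μ,ν,n,y) − 1‖ ≤ Σ_{k<n} ‖ρ Hol(y + k e_ν, μ, ν) − 1‖`. -/
theorem norm_map_slideLoop_sub_one_le (hρu : ∀ g, ρ g ∈ Matrix.unitaryGroup (Fin N) ℂ) (ζ : LGConfig 4 G)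
    (μ ν : Fin 4) : ∀ (n : ℕ) (y : Site 4),
    ‖ρ (slideLoop ζ μ ν n y) - 1‖ ≤
      ∑ k ∈ Finset.range n, ‖ρ (plaquetteHolonomyZd ζ (y + Pi.single ν (k : ℤ)) μ ν) - 1‖
  | 0, y => by simp [slideLoop_zero]
  | n + 1, y => by
    rw [slideLoop_succ, Finset.sum_range_succ']
    refine (norm_map_mul_sub_one_le ρ hρu _ _).trans ?_
    rw [norm_map_conj_sub_one ρ hρu]
    have ih := norm_map_slideLoop_sub_one_le hρu ζ μ ν n (y + Pi.single ν 1)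
    have hshift : ∀ k : ℕ, y + Pi.single ν (1 : ℤ) + Pi.single ν (k : ℤ) = y + Pi.single ν ((k + 1 : ℕ) : ℤ) := by
      intro k; rw [add_assoc, single_add_nat]
    simp only [hshift] at ih
    simp only [Nat.cast_zero, Pi.single_zero, add_zero]
    linarith

/-- Hairpin in direction 3: deviation `0`. -/
theorem norm_map_hairpin_three (ζ : LGConfig 4 G) {b R : ℕ} {x : Site 4} (hx : InLayer b R x) :
    ‖ρ (stair b R ζ x * ζ (x, 3) * (stair b R ζ (x + Pi.single 3 1))⁻¹) - 1‖ = 0 := by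
  rw [hairpin_three ζ hx, map_one, sub_self, norm_zero]

/-- **HAIRPIN STOKES, direction 2**: `‖ρ W₂(x) − 1‖ ≤ Σ_{k < combLen R x 3} ‖ρ Hol(combPt3 x + k e₃, 2, 3) − 1‖`. -/
theorem norm_map_hairpin_two_le (hρu : ∀ g, ρ g ∈ Matrix.unitaryGroup (Fin N) ℂ) (ζ : LGConfig 4 G) {b R : ℕ}
    {x : Site 4} (hx : InLayer b R x) :
    ‖ρ (stair b R ζ x * ζ (x, 2) * (stair b R ζ (x + Pi.single 2 1))⁻¹) - 1‖ ≤
      ∑ k ∈ Finset.range (combLen R x 3),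
        ‖ρ (plaquetteHolonomyZd ζ (combPt3 b R x + Pi.single 3 (k : ℤ)) 2 3) - 1‖ := by
  rw [hairpin_two_eq ζ hx, norm_map_conj_sub_one ρ hρu, norm_map_inv_sub_one ρ hρu]
  exact norm_map_slideLoop_sub_one_le ρ hρu ζ 2 3 _ _

/-- **HAIRPIN STOKES, direction 1**: two strips (`combLen R x 3` plaquettes in the `(1,3)` plane from `combPt3 x`, and
`combLen R x 2` plaquettes in the `(1,2)` plane from `combPt2 x`). -/
theorem norm_map_hairpin_one_le (hρu : ∀ g, ρ g ∈ Matrix.unitaryGroup (Fin N) ℂ) (ζ : LGConfig 4 G) {b R : ℕ}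
    {x : Site 4} (hx : InLayer b R x) :
    ‖ρ (stair b R ζ x * ζ (x, 1) * (stair b R ζ (x + Pi.single 1 1))⁻¹) - 1‖ ≤
      ∑ k ∈ Finset.range (combLen R x 3),
          ‖ρ (plaquetteHolonomyZd ζ (combPt3 b R x + Pi.single 3 (k : ℤ)) 1 3) - 1‖ +
        ∑ k ∈ Finset.range (combLen R x 2),
          ‖ρ (plaquetteHolonomyZd ζ (combPt2 b R x + Pi.single 2 (k : ℤ)) 1 2) - 1‖ := by
  rw [hairpin_one_eq ζ hx]
  refine (norm_map_mul_sub_one_le ρ hρu _ _).trans ?_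
  rw [norm_map_conj_sub_one ρ hρu, norm_map_inv_sub_one ρ hρu, norm_map_conj_sub_one ρ hρu,
    norm_map_inv_sub_one ρ hρu]
  exact add_le_add (norm_map_slideLoop_sub_one_le ρ hρu ζ 1 3 _ _) (norm_map_slideLoop_sub_one_le ρ hρu ζ 1 2 _ _)


/-- **HAIRPIN STOKES, uniform in the layer direction `j ≠ 0`** (for `j = 2` the second sum over-estimates, for `j = 3` the
hairpin is trivial): `‖ρ W_j(x) − 1‖ ≤ Σ_{k<n₃} ‖ρ Hol(p₃ + k e₃, j, 3) − 1‖ + Σ_{k<n₂} ‖ρ Hol(p₂ + k e₂, 1, 2) − 1‖`,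
`n_l = combLen R x l`, `p₂ = combPt2 b R x`, `p₃ = combPt3 b R x` — at most `n₃ + n₂` plaquettes, all in the site layer. -/
theorem norm_map_hairpin_sub_one_le (hρu : ∀ g, ρ g ∈ Matrix.unitaryGroup (Fin N) ℂ) (ζ : LGConfig 4 G) {b R : ℕ}
    {x : Site 4} (hx : InLayer b R x) {j : Fin 4} (hj : j ≠ 0) :
    ‖ρ (stair b R ζ x * ζ (x, j) * (stair b R ζ (x + Pi.single j 1))⁻¹) - 1‖ ≤
      ∑ k ∈ Finset.range (combLen R x 3),
          ‖ρ (plaquetteHolonomyZd ζ (combPt3 b R x + Pi.single 3 (k : ℤ)) j 3) - 1‖ +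
        ∑ k ∈ Finset.range (combLen R x 2),
          ‖ρ (plaquetteHolonomyZd ζ (combPt2 b R x + Pi.single 2 (k : ℤ)) 1 2) - 1‖ := by
  have hA : 0 ≤ ∑ k ∈ Finset.range (combLen R x 3),
      ‖ρ (plaquetteHolonomyZd ζ (combPt3 b R x + Pi.single 3 (k : ℤ)) j 3) - 1‖ :=
    Finset.sum_nonneg fun _ _ => norm_nonneg _
  have hB : 0 ≤ ∑ k ∈ Finset.range (combLen R x 2),
      ‖ρ (plaquetteHolonomyZd ζ (combPt2 b R x + Pi.single 2 (k : ℤ)) 1 2) - 1‖ :=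
    Finset.sum_nonneg fun _ _ => norm_nonneg _
  have h123 : j = 1 ∨ j = 2 ∨ j = 3 := by
    fin_cases j
    · exact absurd rfl hj
    · exact Or.inl rfl
    · exact Or.inr (Or.inl rfl)
    · exact Or.inr (Or.inr rfl)
  rcases h123 with rfl | rfl | rfl
  · exact norm_map_hairpin_one_le ρ hρu ζ hx
  · exact (norm_map_hairpin_two_le ρ hρu ζ hx).trans (le_add_of_nonneg_right hB)
  · rw [norm_map_hairpin_three ρ ζ hx]; exact add_nonneg hA hB

/-- **HAIRPIN STOKES, squared (Cauchy–Schwarz)** — the form the row-floor stub R1d consumes (plaquette ENERGIES are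
`‖ρ(σ_q) − 1‖²/2`): `‖ρ W_j(x) − 1‖² ≤ 2·(n₃ Σ_{k<n₃} ‖ρ Hol(p₃ + k e₃, j, 3) − 1‖² + n₂ Σ_{k<n₂} ‖ρ Hol(p₂ + k e₂, 1, 2) − 1‖²)`. -/
theorem norm_map_hairpin_sub_one_sq_le (hρu : ∀ g, ρ g ∈ Matrix.unitaryGroup (Fin N) ℂ) (ζ : LGConfig 4 G) {b R : ℕ}
    {x : Site 4} (hx : InLayer b R x) {j : Fin 4} (hj : j ≠ 0) :
    ‖ρ (stair b R ζ x * ζ (x, j) * (stair b R ζ (x + Pi.single j 1))⁻¹) - 1‖ ^ 2 ≤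
      2 * ((combLen R x 3 : ℝ) * ∑ k ∈ Finset.range (combLen R x 3),
          ‖ρ (plaquetteHolonomyZd ζ (combPt3 b R x + Pi.single 3 (k : ℤ)) j 3) - 1‖ ^ 2 +
        (combLen R x 2 : ℝ) * ∑ k ∈ Finset.range (combLen R x 2),
          ‖ρ (plaquetteHolonomyZd ζ (combPt2 b R x + Pi.single 2 (k : ℤ)) 1 2) - 1‖ ^ 2) := by
  have h := norm_map_hairpin_sub_one_le ρ hρu ζ hx hj
  have hA := sq_sum_le_card_mul_sum_sq (s := Finset.range (combLen R x 3))
    (f := fun k : ℕ => ‖ρ (plaquetteHolonomyZd ζ (combPt3 b R x + Pi.single 3 (k : ℤ)) j 3) - 1‖)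
  have hB := sq_sum_le_card_mul_sum_sq (s := Finset.range (combLen R x 2))
    (f := fun k : ℕ => ‖ρ (plaquetteHolonomyZd ζ (combPt2 b R x + Pi.single 2 (k : ℤ)) 1 2) - 1‖)
  rw [Finset.card_range] at hA hB
  have h0 : 0 ≤ ‖ρ (stair b R ζ x * ζ (x, j) * (stair b R ζ (x + Pi.single j 1))⁻¹) - 1‖ := norm_nonneg _
  have h1 := pow_le_pow_left₀ h0 h 2
  nlinarith [h1, hA, hB,
    sq_nonneg (∑ k ∈ Finset.range (combLen R x 3),
        ‖ρ (plaquetteHolonomyZd ζ (combPt3 b R x + Pi.single 3 (k : ℤ)) j 3) - 1‖ -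
      ∑ k ∈ Finset.range (combLen R x 2),
        ‖ρ (plaquetteHolonomyZd ζ (combPt2 b R x + Pi.single 2 (k : ℤ)) 1 2) - 1‖)]

end Frobenius

section Counting

/-- Length bookkeeping: inside the window `x l ≤ R` each comb segment has at most `2R` steps, so a hairpin sweeps at
most `4R` layer plaquettes. -/
theorem combLen_le {R : ℕ} {x : Site 4} {l : Fin 4} (h : x l ≤ (R : ℤ)) : combLen R x l ≤ 2 * R := by
  unfold combLen
  omega


/-! ### The top-face count (toward R1d): plaquettes touching the row region with base point at height `b` -/

open Summit.QuantumFields.YangMills.Cruxes.IR.Tempered (cellEdges windowCells regionEdges)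
open Summit.QuantumFields.YangMills.Cruxes.IR.FixedMesh

/-- Spatial range of an edge of a standard-frame cell. -/
theorem spatial_of_mem_cellEdges {b : ℕ} {c : Fin 4 → ℤ} {e : ZdEdge 4} (he : e ∈ cellEdges (stdFrame b) c)
    {i : Fin 4} (hi : i ≠ 0) : (b : ℤ) * c i ≤ e.1 i ∧ e.1 i < (b : ℤ) * (c i + 1) := by
  have h := Fintype.mem_piFinset.1 (Finset.mem_product.1 he).1 i
  have h' := Finset.mem_Ico.1 h
  simp only [stdFrame, if_neg hi] at h'
  exact h'

/-- The bounding box of the row region `Λ = rowRegion b n`: heights `1 … b`, spatial coordinates in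
`[-2nb, (2n+1)b - 1]`. -/
theorem box_of_mem_rowRegion {b n : ℕ} {e : ZdEdge 4} (he : e ∈ rowRegion b n) :
    (1 ≤ e.1 0 ∧ e.1 0 ≤ (b : ℤ)) ∧
      ∀ i : Fin 4, i ≠ 0 → -(2 * (n : ℤ) * b) ≤ e.1 i ∧ e.1 i ≤ (2 * (n : ℤ) + 1) * b - 1 := by
  unfold rowRegion regionEdges at he
  obtain ⟨c, hc, hec⟩ := Finset.mem_biUnion.1 he
  have hcw := Finset.mem_filter.1 (show c ∈ (windowCells n).filter (fun y => y 0 = 0) from hc)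
  have hc0 : c 0 = 0 := hcw.2
  have hcI : ∀ i, -(2 * (n : ℤ)) ≤ c i ∧ c i ≤ 2 * (n : ℤ) := fun i => by
    have h := Fintype.mem_piFinset.1 hcw.1 i
    rw [Finset.mem_Icc] at h
    exact_mod_cast h
  have hb0 : (0 : ℤ) ≤ (b : ℤ) := Int.natCast_nonneg b
  refine ⟨?_, fun i hi => ?_⟩
  · have h := base_height_of_mem_cellEdges hec
    rw [hc0] at h
    constructor <;> linarith [h.1, h.2]
  · have h := spatial_of_mem_cellEdges hec hi
    have h1 := mul_le_mul_of_nonneg_left (hcI i).1 hb0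
    have h2 := mul_le_mul_of_nonneg_left (show c i + 1 ≤ 2 * (n : ℤ) + 1 by linarith [(hcI i).2]) hb0
    constructor <;> linarith [h.1, h.2]

/-- The box containing the base points of the TOP-FACE plaquettes touching `Λ`: height exactly `b`, spatial coordinates in
`[-2nb - 1, (2n+1)b - 1]`. -/
def topBox (b n : ℕ) : Finset (Site 4) :=
  Fintype.piFinset fun i : Fin 4 =>
    if i = 0 then {(b : ℤ)} else Finset.Icc (-(2 * (n : ℤ) * b) - 1) ((2 * (n : ℤ) + 1) * b - 1)

theorem card_topBox (b n : ℕ) : (topBox b n).card = ((4 * n + 1) * b + 1) ^ 3 := by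
  rw [topBox, Fintype.card_piFinset, Fin.prod_univ_four, if_pos rfl, if_neg (show (1 : Fin 4) ≠ 0 by decide),
    if_neg (show (2 : Fin 4) ≠ 0 by decide), if_neg (show (3 : Fin 4) ≠ 0 by decide), Finset.card_singleton,
    Int.card_Icc]
  have h : (2 * (n : ℤ) + 1) * b - 1 + 1 - (-(2 * (n : ℤ) * b) - 1) = (((4 * n + 1) * b + 1 : ℕ) : ℤ) := by
    push_cast; ring
  rw [h, Int.toNat_natCast]
  ring

/-- A top-face plaquette (base height `b`) touching `Λ` has its base point in `topBox b n`. -/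
theorem mem_topBox_of_touching {b n : ℕ} {q : ZdPlaquette 4} (hq : q ∈ plaquettesTouching (rowRegion b n))
    (hq0 : q.1 0 = (b : ℤ)) : q.1 ∈ topBox b n := by
  rw [mem_plaquettesTouching_iff] at hq
  obtain ⟨e, he⟩ := hq
  rw [Finset.mem_inter] at he
  obtain ⟨he1, he2⟩ := he
  rw [topBox, Fintype.mem_piFinset]
  intro i
  by_cases hi : i = 0
  · subst hi
    rw [if_pos rfl, Finset.mem_singleton, hq0]
  · rw [if_neg hi, Finset.mem_Icc]
    have hs := (box_of_mem_rowRegion he2).2 i hi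
    simp only [plaquetteEdges, Finset.mem_insert, Finset.mem_singleton] at he1
    rcases he1 with rfl | rfl | rfl | rfl
    · dsimp only at hs
      constructor <;> linarith [hs.1, hs.2]
    · dsimp only at hs
      rw [Pi.add_apply, Pi.single_apply] at hs
      split_ifs at hs <;> constructor <;> linarith [hs.1, hs.2]
    · dsimp only at hs
      rw [Pi.add_apply, Pi.single_apply] at hs
      split_ifs at hs <;> constructor <;> linarith [hs.1, hs.2]
    · dsimp only at hs
      constructor <;> linarith [hs.1, hs.2]

/-- **THE TOP-FACE COUNT (PROVED):** the plaquettes touching `Λ = rowRegion b n` whose base point has height `b` (in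
particular all TOP-FACE plaquettes `(x, 0, j)`, `x 0 = b`, the only ones the layer twist changes) number
`≤ 6·((4n+1)b + 1)³ ≤ C(n) b³`. -/
theorem card_touching_height_eq_le (b n : ℕ) :
    ((plaquettesTouching (rowRegion b n)).filter (fun q => q.1 0 = (b : ℤ))).card ≤
      Fintype.card {p : Fin 4 × Fin 4 // p.1 < p.2} * ((4 * n + 1) * b + 1) ^ 3 := by
  have hsub : (plaquettesTouching (rowRegion b n)).filter (fun q => q.1 0 = (b : ℤ)) ⊆
      topBox b n ×ˢ (Finset.univ : Finset {p : Fin 4 × Fin 4 // p.1 < p.2}) := by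
    intro q hq
    rw [Finset.mem_filter] at hq
    exact Finset.mem_product.2 ⟨mem_topBox_of_touching hq.1 hq.2, Finset.mem_univ _⟩
  refine (Finset.card_le_card hsub).trans ?_
  rw [Finset.card_product, card_topBox, Finset.card_univ, mul_comm]

/-- The number of plaquette orientations in `ℤ⁴`. -/
theorem card_orientations : Fintype.card {p : Fin 4 × Fin 4 // p.1 < p.2} = 6 := by
  decide

end Counting

section TopFace

/-! ### The twisted configuration plaquette by plaquette (copied from `CruxIdea2RowFloorPoly.lean` §4m, which cannot be imported) -/

open scoped Matrix Matrix.Norms.Frobenius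

variable {G : Type} [Group G] {N : ℕ} (ρ : G →* Matrix (Fin N) (Fin N) ℂ)

/-- `N − Re tr ρ(g) = ‖ρ(g) − 1‖²_F / 2` for unitary `ρ` (copy of the row-floor file's lemma). -/
theorem sub_re_trace_eq_norm_sq (hρu : ∀ g, ρ g ∈ Matrix.unitaryGroup (Fin N) ℂ) (g : G) :
    (N : ℝ) - (ρ g).trace.re = ‖ρ g - 1‖ ^ 2 / 2 := by
  have hU : (ρ g)ᴴ * ρ g = 1 := Matrix.mem_unitaryGroup_iff'.1 (hρu g)
  have h1 : ‖ρ g - 1‖ ^ 2 = RCLike.re (Matrix.trace ((ρ g - 1)ᴴ * (ρ g - 1))) :=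
    Matrix.frobenius_norm_sq_eq_re_trace _
  have h2 : (ρ g - 1)ᴴ * (ρ g - 1) = 2 • (1 : Matrix (Fin N) (Fin N) ℂ) - ρ g - (ρ g)ᴴ := by
    rw [Matrix.conjTranspose_sub, Matrix.conjTranspose_one, sub_mul, mul_sub, mul_sub, hU, one_mul,
      mul_one, one_mul, two_smul]
    abel
  rw [h1, h2]
  simp only [Matrix.trace_sub, Matrix.trace_smul, Matrix.trace_one, Fintype.card_fin, map_sub,
    Matrix.trace_conjTranspose, RCLike.star_def, RCLike.conj_re]
  simp only [RCLike.re_to_complex, nsmul_eq_mul, Complex.mul_re]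
  norm_num
  ring

/-- The twist changes only temporal links. -/
theorem topTwist_apply_of_dir_ne {b : ℕ} (k : Site 4 → G) (U : LGConfig 4 G) {e : ZdEdge 4} (he : e.2 ≠ 0) :
    topTwist b k U e = U e := by
  unfold topTwist; exact if_neg fun h => he h.1

/-- **PROVED (cases, I).** A plaquette `(x, i, j)` (`j ≠ 0`) that is NOT a top-face plaquette (`¬(i = 0 ∧ x₀ = b)`) has the same
holonomy in the twisted configuration as in `σ` — whatever the twisting field `k`. -/
theorem plaquetteHolonomyZd_topTwist_of_not_topFace (b : ℕ) (k : Site 4 → G) (σ : LGConfig 4 G) (x : Site 4)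
    {i j : Fin 4} (hj : j ≠ 0) (h : ¬ (i = 0 ∧ x 0 = (b : ℤ))) :
    plaquetteHolonomyZd (topTwist b k σ) x i j = plaquetteHolonomyZd σ x i j := by
  unfold plaquetteHolonomyZd
  have e2 : topTwist b k σ (x + Pi.single i 1, j) = σ (x + Pi.single i 1, j) := topTwist_apply_of_dir_ne k σ hj
  have e4 : topTwist b k σ (x, j) = σ (x, j) := topTwist_apply_of_dir_ne k σ hj
  by_cases hi : i = 0
  · have hx : x 0 ≠ (b : ℤ) := fun hx => h ⟨hi, hx⟩
    have e1 : topTwist b k σ (x, i) = σ (x, i) := topTwist_apply_of_ne k σ hx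
    have hx' : ((x + Pi.single j (1 : ℤ) : Site 4)) 0 ≠ (b : ℤ) := by
      rw [add_single_apply_zero, if_neg hj, add_zero]; exact hx
    have e3 : topTwist b k σ (x + Pi.single j 1, i) = σ (x + Pi.single j 1, i) := topTwist_apply_of_ne k σ hx'
    rw [e1, e2, e3, e4]
  · have e1 : topTwist b k σ (x, i) = σ (x, i) := topTwist_apply_of_dir_ne k σ hi
    have e3 : topTwist b k σ (x + Pi.single j 1, i) = σ (x + Pi.single j 1, i) := topTwist_apply_of_dir_ne k σ hi
    rw [e1, e2, e3, e4]

/-- The LINK DEFECT of the twisting field `k` across the layer link `(y, j)`: `k(y)⁻¹ σ(y,j) k(y+e_j) σ(y,j)⁻¹` (`= 1` iff `k` is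
covariantly constant along the link). -/
def linkDefect (k : Site 4 → G) (σ : LGConfig 4 G) (y : Site 4) (j : Fin 4) : G :=
  (k y)⁻¹ * σ (y, j) * k (y + Pi.single j 1) * (σ (y, j))⁻¹

/-- **PROVED (cases, II).** A TOP-FACE plaquette `(x, 0, j)`, `x₀ = b`, `j ≠ 0`: its twisted holonomy is the untwisted one
multiplied by a conjugate of the link defect of `k` across the layer link `(x + e₀, j)`. -/
theorem plaquetteHolonomyZd_topTwist_topFace (b : ℕ) (k : Site 4 → G) (σ : LGConfig 4 G) (x : Site 4) {j : Fin 4}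
    (hj : j ≠ 0) (hx : x 0 = (b : ℤ)) :
    plaquetteHolonomyZd (topTwist b k σ) x 0 j =
      σ (x, 0) * linkDefect k σ (x + Pi.single 0 1) j * (σ (x, 0))⁻¹ * plaquetteHolonomyZd σ x 0 j := by
  unfold plaquetteHolonomyZd linkDefect
  have e1 : topTwist b k σ (x, 0) = σ (x, 0) * (k (x + Pi.single 0 1))⁻¹ := by
    unfold topTwist; exact if_pos ⟨rfl, hx⟩
  have e2 : topTwist b k σ (x + Pi.single 0 1, j) = σ (x + Pi.single 0 1, j) := topTwist_apply_of_dir_ne k σ hj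
  have hx' : ((x + Pi.single j (1 : ℤ) : Site 4)) 0 = (b : ℤ) := by
    rw [add_single_apply_zero, if_neg hj, add_zero]; exact hx
  have e3 : topTwist b k σ (x + Pi.single j 1, 0) =
      σ (x + Pi.single j 1, 0) * (k (x + Pi.single j 1 + Pi.single 0 1))⁻¹ := by
    unfold topTwist; exact if_pos ⟨rfl, hx'⟩
  have e4 : topTwist b k σ (x, j) = σ (x, j) := topTwist_apply_of_dir_ne k σ hj
  rw [e1, e2, e3, e4]
  have hc : x + Pi.single j (1 : ℤ) + Pi.single 0 1 = x + Pi.single 0 1 + Pi.single j 1 := add_right_comm _ _ _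
  rw [hc]
  group

/-- **PROVED (algebra, I).** ENERGY OF A TOP-FACE PLAQUETTE of the twisted configuration: `≤ ‖ρ(link defect) − 1‖²_F +
2·φ_p(σ)` (`‖AB − 1‖ ≤ ‖A − 1‖ + ‖B − 1‖` for unitaries, conjugation invariance, `N − Re tr ρ U = ‖ρ U − 1‖²_F/2`). -/
theorem topFace_energy_le (hρu : ∀ g, ρ g ∈ Matrix.unitaryGroup (Fin N) ℂ) (b : ℕ) (k : Site 4 → G)
    (σ : LGConfig 4 G) (x : Site 4) {j : Fin 4} (hj : j ≠ 0) (hx : x 0 = (b : ℤ)) :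
    (N : ℝ) - plaquetteObs ρ x 0 j (topTwist b k σ) ≤
      ‖ρ (linkDefect k σ (x + Pi.single 0 1) j) - 1‖ ^ 2 + 2 * ((N : ℝ) - plaquetteObs ρ x 0 j σ) := by
  unfold plaquetteObs
  rw [plaquetteHolonomyZd_topTwist_topFace b k σ x hj hx, sub_re_trace_eq_norm_sq ρ hρu, sub_re_trace_eq_norm_sq ρ hρu]
  have h1 : ‖ρ (σ (x, 0) * linkDefect k σ (x + Pi.single 0 1) j * (σ (x, 0))⁻¹ * plaquetteHolonomyZd σ x 0 j) - 1‖ ≤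
      ‖ρ (linkDefect k σ (x + Pi.single 0 1) j) - 1‖ + ‖ρ (plaquetteHolonomyZd σ x 0 j) - 1‖ := by
    calc _ ≤ ‖ρ (σ (x, 0) * linkDefect k σ (x + Pi.single 0 1) j * (σ (x, 0))⁻¹) - 1‖ +
          ‖ρ (plaquetteHolonomyZd σ x 0 j) - 1‖ := norm_map_mul_sub_one_le ρ hρu _ _
      _ = _ := by rw [norm_map_conj_sub_one ρ hρu]
  nlinarith [h1, norm_nonneg (ρ (σ (x, 0) * linkDefect k σ (x + Pi.single 0 1) j * (σ (x, 0))⁻¹ *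
    plaquetteHolonomyZd σ x 0 j) - 1), norm_nonneg (ρ (linkDefect k σ (x + Pi.single 0 1) j) - 1),
    norm_nonneg (ρ (plaquetteHolonomyZd σ x 0 j) - 1),
    sq_nonneg (‖ρ (linkDefect k σ (x + Pi.single 0 1) j) - 1‖ - ‖ρ (plaquetteHolonomyZd σ x 0 j) - 1‖)]

/-- The comb HAIRPIN holonomy across the layer link `(y, j)`: `W = stair(y)·σ(y,j)·stair(y+e_j)⁻¹` (a closed staircase loop
through the comb root; `= 1` for flat `σ` in the layer — `stair_add_single_of_flatZd` — and identically for `j = 3`). -/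
def hairpin (b R : ℕ) (σ : LGConfig 4 G) (y : Site 4) (j : Fin 4) : G :=
  stair b R σ y * σ (y, j) * (stair b R σ (y + Pi.single j 1))⁻¹

/-- **PROVED (algebra, II).** The link defect of the COMB is conjugate to the commutator `k₀⁻¹ W k₀ W⁻¹` of `k₀` with the
hairpin holonomy, hence `‖ρ(defect) − 1‖_F ≤ 2‖ρ(W) − 1‖_F`. -/
theorem norm_linkDefect_comb_le (hρu : ∀ g, ρ g ∈ Matrix.unitaryGroup (Fin N) ℂ) (b R : ℕ) (k₀ : G)
    (σ : LGConfig 4 G) (y : Site 4) (j : Fin 4) :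
    ‖ρ (linkDefect (comb b R k₀ σ) σ y j) - 1‖ ≤ 2 * ‖ρ (hairpin b R σ y j) - 1‖ := by
  have hD : linkDefect (comb b R k₀ σ) σ y j =
      (stair b R σ y)⁻¹ * (k₀⁻¹ * hairpin b R σ y j * k₀ * (hairpin b R σ y j)⁻¹) * (stair b R σ y)⁻¹⁻¹ := by
    unfold linkDefect comb hairpin; group
  rw [hD, norm_map_conj_sub_one ρ hρu]
  have h1 := norm_map_mul_sub_one_le ρ hρu (k₀⁻¹ * hairpin b R σ y j * k₀) (hairpin b R σ y j)⁻¹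
  have h2 := norm_map_conj_sub_one ρ hρu k₀⁻¹ (hairpin b R σ y j)
  rw [inv_inv] at h2
  rw [norm_map_inv_sub_one ρ hρu, h2] at h1
  linarith

/-- **PROVED (the top-face bound with the comb).** `energy_p(σ') ≤ 4‖ρ(W_p) − 1‖²_F + 2φ_p(σ)` for every top-face plaquette
`p = (x, 0, j)`, `W_p` the hairpin across the layer link above it.  What remains for R1d: the HAIRPIN STOKES bound
`‖ρ(W) − 1‖_F ≤ Σ_{hairpin plaquettes} ‖ρ(σ_q) − 1‖_F` (`≤ combLen y 2 + combLen y 3 ≤ 4R` plaquettes), Cauchy–Schwarz and counting. -/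
theorem topFace_energy_comb_le (hρu : ∀ g, ρ g ∈ Matrix.unitaryGroup (Fin N) ℂ) (b R : ℕ) (k₀ : G)
    (σ : LGConfig 4 G) (x : Site 4) {j : Fin 4} (hj : j ≠ 0) (hx : x 0 = (b : ℤ)) :
    (N : ℝ) - plaquetteObs ρ x 0 j (topTwist b (comb b R k₀ σ) σ) ≤
      4 * ‖ρ (hairpin b R σ (x + Pi.single 0 1) j) - 1‖ ^ 2 + 2 * ((N : ℝ) - plaquetteObs ρ x 0 j σ) := by
  have h1 := topFace_energy_le ρ hρu b (comb b R k₀ σ) σ x hj hx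
  have h2 := norm_linkDefect_comb_le ρ hρu b R k₀ σ (x + Pi.single 0 1) j
  have h0 := norm_nonneg (ρ (linkDefect (comb b R k₀ σ) σ (x + Pi.single 0 1) j) - 1)
  nlinarith [h1, h2, h0]

/-- **PROVED (cases, I, as energies).** Off the top face the twisted configuration has the plaquette energies of `σ`. -/
theorem energy_topTwist_of_not_topFace (b : ℕ) (k : Site 4 → G) (σ : LGConfig 4 G) (q : ZdPlaquette 4)
    (h : ¬ (q.2.1.1 = 0 ∧ q.1 0 = (b : ℤ))) :
    (N : ℝ) - plaquetteObs ρ q.1 q.2.1.1 q.2.1.2 (topTwist b k σ) = (N : ℝ) - plaquetteObs ρ q.1 q.2.1.1 q.2.1.2 σ := by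
  have hj : q.2.1.2 ≠ 0 := fun h0 => by have := q.2.2; rw [h0] at this; exact (Fin.not_lt_zero _) this
  unfold plaquetteObs
  rw [plaquetteHolonomyZd_topTwist_of_not_topFace b k σ q.1 hj h]


end TopFace

section Assembly

/-! ### R1d′ — THE ASSEMBLY: the boundary Wilson action of the twisted configuration is dominated by a fixed weighted sum of
plaquette energies of `σ`, total weight `≤ C(n) b⁵` -/

open scoped Matrix Matrix.Norms.Frobenius
open Summit.QuantumFields.YangMills.Cruxes.IR.FixedMesh

variable {G : Type} [Group G] {N : ℕ} (ρ : G →* Matrix (Fin N) (Fin N) ℂ)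

/-- The plaquette energy `N − Re tr ρ(σ_q)` of the plaquette `q`. -/
def pe (q : ZdPlaquette 4) (σ : LGConfig 4 G) : ℝ := (N : ℝ) - plaquetteObs ρ q.1 q.2.1.1 q.2.1.2 σ

theorem pe_nonneg (hρu : ∀ g, ρ g ∈ Matrix.unitaryGroup (Fin N) ℂ) (q : ZdPlaquette 4) (σ : LGConfig 4 G) :
    0 ≤ pe ρ q σ := by
  unfold pe plaquetteObs
  rw [sub_re_trace_eq_norm_sq ρ hρu]
  positivity

theorem norm_sq_eq_two_mul_energy (hρu : ∀ g, ρ g ∈ Matrix.unitaryGroup (Fin N) ℂ) (x : Site 4) (i j : Fin 4)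
    (σ : LGConfig 4 G) :
    ‖ρ (plaquetteHolonomyZd σ x i j) - 1‖ ^ 2 = 2 * ((N : ℝ) - plaquetteObs ρ x i j σ) := by
  unfold plaquetteObs
  rw [sub_re_trace_eq_norm_sq ρ hρu]
  ring

theorem wilsonBoundaryAction_eq_sum_pe (Λ : Finset (ZdEdge 4)) (σ : LGConfig 4 G) :
    wilsonBoundaryAction ρ Λ σ = ∑ q ∈ plaquettesTouching Λ, pe ρ q σ := rfl

/-- The `k`-th plaquette of the direction-3 strip of the hairpin across the layer link `(y, j)` (`j < 3`; junk otherwise). -/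
def hp3 (b R : ℕ) (y : Site 4) (j : Fin 4) (k : ℕ) : ZdPlaquette 4 :=
  if h : j < 3 then (combPt3 b R y + Pi.single 3 (k : ℤ), ⟨(j, 3), h⟩) else (y, ⟨(0, 1), by decide⟩)

/-- The `k`-th plaquette of the direction-2 strip of the hairpin across a layer link in direction 1 at `y`. -/
def hp2 (b R : ℕ) (y : Site 4) (k : ℕ) : ZdPlaquette 4 :=
  (combPt2 b R y + Pi.single 2 (k : ℤ), ⟨(1, 2), by decide⟩)

/-- The COEFFICIENT of the plaquette `p` (energies of `σ`) in the bound for the energy of the plaquette `q` of the twisted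
configuration: `2·[q = p]`, plus, for a top-face `q`, `32 R` times the multiplicity of `p` among the hairpin plaquettes of `q`. -/
def coef (b R : ℕ) (q p : ZdPlaquette 4) : ℝ :=
  2 * (if q = p then 1 else 0) +
    if q.2.1.1 = 0 ∧ q.1 0 = (b : ℤ) then
      32 * (R : ℝ) *
        ((∑ k ∈ Finset.range (combLen R (q.1 + Pi.single 0 1) 3),
            if hp3 b R (q.1 + Pi.single 0 1) q.2.1.2 k = p then (1 : ℝ) else 0) +
          ∑ k ∈ Finset.range (combLen R (q.1 + Pi.single 0 1) 2),
            if hp2 b R (q.1 + Pi.single 0 1) k = p then (1 : ℝ) else 0)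
    else 0

theorem coef_nonneg (b R : ℕ) (q p : ZdPlaquette 4) : 0 ≤ coef b R q p := by
  unfold coef
  have h1 : (0 : ℝ) ≤ 2 * (if q = p then 1 else 0) := by split_ifs <;> norm_num
  have h2 : (0 : ℝ) ≤ ∑ k ∈ Finset.range (combLen R (q.1 + Pi.single 0 1) 3),
      (if hp3 b R (q.1 + Pi.single 0 1) q.2.1.2 k = p then (1 : ℝ) else 0) :=
    Finset.sum_nonneg fun k _ => by split_ifs <;> norm_num
  have h3 : (0 : ℝ) ≤ ∑ k ∈ Finset.range (combLen R (q.1 + Pi.single 0 1) 2),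
      (if hp2 b R (q.1 + Pi.single 0 1) k = p then (1 : ℝ) else 0) :=
    Finset.sum_nonneg fun k _ => by split_ifs <;> norm_num
  split_ifs <;> positivity

theorem sum_ite_eq_mul {α : Type} [DecidableEq α] (P : Finset α) (a : α) (f : α → ℝ) (ha : a ∈ P) :
    ∑ p ∈ P, (if a = p then (1 : ℝ) else 0) * f p = f a := by
  rw [Finset.sum_eq_single a (fun p _ hp => by rw [if_neg (Ne.symm hp), zero_mul]) (fun h => (h ha).elim),
    if_pos rfl, one_mul]

theorem sum_sum_ite_eq_mul {α : Type} [DecidableEq α] (P : Finset α) (s : Finset ℕ) (h : ℕ → α) (f : α → ℝ)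
    (hh : ∀ k ∈ s, h k ∈ P) :
    ∑ p ∈ P, (∑ k ∈ s, if h k = p then (1 : ℝ) else 0) * f p = ∑ k ∈ s, f (h k) := by
  simp_rw [Finset.sum_mul]
  rw [Finset.sum_comm]
  exact Finset.sum_congr rfl fun k hk => sum_ite_eq_mul P (h k) f (hh k hk)

/-- Evaluation of `Σ_p coef(q,p)·f(p)` when `P` contains `q` and its hairpin plaquettes. -/
theorem sum_coef_mul (b R : ℕ) (P : Finset (ZdPlaquette 4)) (f : ZdPlaquette 4 → ℝ) (q : ZdPlaquette 4)
    (hq : q ∈ P)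
    (h3 : ∀ k ∈ Finset.range (combLen R (q.1 + Pi.single 0 1) 3), hp3 b R (q.1 + Pi.single 0 1) q.2.1.2 k ∈ P)
    (h2 : ∀ k ∈ Finset.range (combLen R (q.1 + Pi.single 0 1) 2), hp2 b R (q.1 + Pi.single 0 1) k ∈ P) :
    ∑ p ∈ P, coef b R q p * f p =
      2 * f q +
        if q.2.1.1 = 0 ∧ q.1 0 = (b : ℤ) then
          32 * (R : ℝ) *
            (∑ k ∈ Finset.range (combLen R (q.1 + Pi.single 0 1) 3), f (hp3 b R (q.1 + Pi.single 0 1) q.2.1.2 k) +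
              ∑ k ∈ Finset.range (combLen R (q.1 + Pi.single 0 1) 2), f (hp2 b R (q.1 + Pi.single 0 1) k))
        else 0 := by
  unfold coef
  by_cases ht : q.2.1.1 = 0 ∧ q.1 0 = (b : ℤ)
  · simp only [if_pos ht]
    have hsplit : ∀ p ∈ P,
        (2 * (if q = p then 1 else 0) + 32 * (R : ℝ) *
          ((∑ k ∈ Finset.range (combLen R (q.1 + Pi.single 0 1) 3),
              if hp3 b R (q.1 + Pi.single 0 1) q.2.1.2 k = p then (1 : ℝ) else 0) +
            ∑ k ∈ Finset.range (combLen R (q.1 + Pi.single 0 1) 2),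
              if hp2 b R (q.1 + Pi.single 0 1) k = p then (1 : ℝ) else 0)) * f p =
        2 * ((if q = p then 1 else 0) * f p) +
          (32 * (R : ℝ) * ((∑ k ∈ Finset.range (combLen R (q.1 + Pi.single 0 1) 3),
              if hp3 b R (q.1 + Pi.single 0 1) q.2.1.2 k = p then (1 : ℝ) else 0) * f p) +
           32 * (R : ℝ) * ((∑ k ∈ Finset.range (combLen R (q.1 + Pi.single 0 1) 2),
              if hp2 b R (q.1 + Pi.single 0 1) k = p then (1 : ℝ) else 0) * f p)) := by
      intro p _; ring
    rw [Finset.sum_congr rfl hsplit, Finset.sum_add_distrib, Finset.sum_add_distrib, ← Finset.mul_sum, ← Finset.mul_sum,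
      ← Finset.mul_sum, sum_ite_eq_mul P q f hq, sum_sum_ite_eq_mul P _ _ f h3, sum_sum_ite_eq_mul P _ _ f h2]
    ring
  · simp only [if_neg ht, add_zero]
    have hsplit : ∀ p ∈ P, (2 * (if q = p then 1 else 0)) * f p = 2 * ((if q = p then (1 : ℝ) else 0) * f p) := by
      intro p _; ring
    rw [Finset.sum_congr rfl hsplit, ← Finset.mul_sum, sum_ite_eq_mul P q f hq]

/-- **THE TOP-FACE PLAQUETTE BOUND (analysis assembled).** For a top-face plaquette `q = (x, 0, j)` (`x₀ = b`) touching
`Λ = rowRegion b n` and `R ≥ (2n+1)b`: `energy_q(σ') ≤ 2·energy_q(σ) + 32R·(Σ hairpin-strip energies of σ)`. -/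
theorem pe_twist_top_le (hρu : ∀ g, ρ g ∈ Matrix.unitaryGroup (Fin N) ℂ) {b n R : ℕ} (hb : 1 ≤ b)
    (hR : (2 * n + 1) * b ≤ R) (k₀ : G) (σ : LGConfig 4 G) {q : ZdPlaquette 4}
    (hq : q ∈ plaquettesTouching (rowRegion b n)) (ht : q.2.1.1 = 0 ∧ q.1 0 = (b : ℤ)) :
    pe ρ q (topTwist b (comb b R k₀ σ) σ) ≤
      2 * pe ρ q σ +
        32 * (R : ℝ) *
          (∑ k ∈ Finset.range (combLen R (q.1 + Pi.single 0 1) 3), pe ρ (hp3 b R (q.1 + Pi.single 0 1) q.2.1.2 k) σ +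
            ∑ k ∈ Finset.range (combLen R (q.1 + Pi.single 0 1) 2), pe ρ (hp2 b R (q.1 + Pi.single 0 1) k) σ) := by
  have hbox := mem_topBox_of_touching hq ht.2
  rw [topBox, Fintype.mem_piFinset] at hbox
  obtain ⟨x, ⟨⟨i, j⟩, hij⟩⟩ := q
  dsimp only at ht hbox hij ⊢
  obtain ⟨hi, hx⟩ := ht
  subst hi
  have hj0 : j ≠ 0 := by rintro rfl; exact lt_irrefl _ hij
  have hsp : ∀ l : Fin 4, l ≠ 0 → -(2 * (n : ℤ) * b) - 1 ≤ x l ∧ x l ≤ (2 * (n : ℤ) + 1) * b - 1 := fun l hl => by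
    have h := hbox l
    rw [if_neg hl, Finset.mem_Icc] at h
    exact h
  have hyl : ∀ l : Fin 4, l ≠ 0 → ((x + Pi.single (0 : Fin 4) (1 : ℤ) : Site 4)) l = x l := fun l hl => by
    rw [Pi.add_apply, Pi.single_apply, if_neg hl, add_zero]
  have hy0 : ((x + Pi.single (0 : Fin 4) (1 : ℤ) : Site 4)) 0 = (b : ℤ) + 1 := by
    rw [Pi.add_apply, Pi.single_eq_same, hx]
  have hRz : (((2 * n + 1) * b : ℕ) : ℤ) ≤ (R : ℤ) := by exact_mod_cast hR
  push_cast at hRz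
  have hbz : (1 : ℤ) ≤ (b : ℤ) := by exact_mod_cast hb
  have hy : InLayer b R (x + Pi.single 0 1) :=
    ⟨hy0, fun l hl => by rw [hyl l hl]; linarith [(hsp l hl).1]⟩
  have hle : ∀ l : Fin 4, l ≠ 0 → ((x + Pi.single (0 : Fin 4) (1 : ℤ) : Site 4)) l ≤ (R : ℤ) := fun l hl => by
    rw [hyl l hl]; linarith [(hsp l hl).2]
  have hn3 : (combLen R (x + Pi.single 0 1) 3 : ℝ) ≤ 2 * R := by
    exact_mod_cast combLen_le (hle 3 (by decide))
  have hn2 : (combLen R (x + Pi.single 0 1) 2 : ℝ) ≤ 2 * R := by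
    exact_mod_cast combLen_le (hle 2 (by decide))
  have h1 := topFace_energy_comb_le ρ hρu b R k₀ σ x hj0 hx
  have hS3 : 0 ≤ ∑ k ∈ Finset.range (combLen R (x + Pi.single 0 1) 3), pe ρ (hp3 b R (x + Pi.single 0 1) j k) σ :=
    Finset.sum_nonneg fun k _ => pe_nonneg ρ hρu _ _
  have hS2 : 0 ≤ ∑ k ∈ Finset.range (combLen R (x + Pi.single 0 1) 2), pe ρ (hp2 b R (x + Pi.single 0 1) k) σ :=
    Finset.sum_nonneg fun k _ => pe_nonneg ρ hρu _ _
  have hR0 : (0 : ℝ) ≤ (R : ℝ) := Nat.cast_nonneg R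
  unfold pe at hS3 hS2 ⊢
  dsimp only at hS3 hS2 ⊢
  by_cases hj3 : j = 3
  · subst hj3
    have h0 : ‖ρ (hairpin b R σ (x + Pi.single 0 1) 3) - 1‖ = 0 := norm_map_hairpin_three ρ σ hy
    rw [h0] at h1
    norm_num at h1
    nlinarith [h1, hS3, hS2, hR0, mul_nonneg hR0 (add_nonneg hS3 hS2)]
  · have hj3' : j < 3 := Fin.lt_last_iff_ne_last.2 hj3
    have h2 : ‖ρ (hairpin b R σ (x + Pi.single 0 1) j) - 1‖ ^ 2 ≤ _ :=
      norm_map_hairpin_sub_one_sq_le ρ hρu σ hy hj0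
    have e3 : ∑ k ∈ Finset.range (combLen R (x + Pi.single 0 1) 3),
        ‖ρ (plaquetteHolonomyZd σ (combPt3 b R (x + Pi.single 0 1) + Pi.single 3 (k : ℤ)) j 3) - 1‖ ^ 2 =
        ∑ k ∈ Finset.range (combLen R (x + Pi.single 0 1) 3),
          2 * ((N : ℝ) - plaquetteObs ρ (hp3 b R (x + Pi.single 0 1) j k).1 (hp3 b R (x + Pi.single 0 1) j k).2.1.1
            (hp3 b R (x + Pi.single 0 1) j k).2.1.2 σ) :=
      Finset.sum_congr rfl fun k _ => by rw [norm_sq_eq_two_mul_energy ρ hρu]; simp only [hp3, dif_pos hj3']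
    have e2 : ∑ k ∈ Finset.range (combLen R (x + Pi.single 0 1) 2),
        ‖ρ (plaquetteHolonomyZd σ (combPt2 b R (x + Pi.single 0 1) + Pi.single 2 (k : ℤ)) 1 2) - 1‖ ^ 2 =
        ∑ k ∈ Finset.range (combLen R (x + Pi.single 0 1) 2),
          2 * ((N : ℝ) - plaquetteObs ρ (hp2 b R (x + Pi.single 0 1) k).1 (hp2 b R (x + Pi.single 0 1) k).2.1.1
            (hp2 b R (x + Pi.single 0 1) k).2.1.2 σ) :=
      Finset.sum_congr rfl fun k _ => by rw [norm_sq_eq_two_mul_energy ρ hρu]; simp only [hp2]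
    rw [e3, e2, ← Finset.mul_sum, ← Finset.mul_sum] at h2
    have hm3 := mul_le_mul_of_nonneg_right hn3 hS3
    have hm2 := mul_le_mul_of_nonneg_right hn2 hS2
    nlinarith [h1, h2, hm3, hm2, hS3, hS2, hR0]

/-- **THE PER-PLAQUETTE BOUND.** Every plaquette `q` touching `Λ`: `energy_q(σ') ≤ Σ_p coef(q,p)·energy_p(σ)` whenever `P`
contains `q` and its hairpin plaquettes. -/
theorem pe_twist_le_sum_coef (hρu : ∀ g, ρ g ∈ Matrix.unitaryGroup (Fin N) ℂ) {b n R : ℕ} (hb : 1 ≤ b)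
    (hR : (2 * n + 1) * b ≤ R) (k₀ : G) (σ : LGConfig 4 G) (P : Finset (ZdPlaquette 4)) {q : ZdPlaquette 4}
    (hqT : q ∈ plaquettesTouching (rowRegion b n)) (hq : q ∈ P)
    (h3 : ∀ k ∈ Finset.range (combLen R (q.1 + Pi.single 0 1) 3), hp3 b R (q.1 + Pi.single 0 1) q.2.1.2 k ∈ P)
    (h2 : ∀ k ∈ Finset.range (combLen R (q.1 + Pi.single 0 1) 2), hp2 b R (q.1 + Pi.single 0 1) k ∈ P) :
    pe ρ q (topTwist b (comb b R k₀ σ) σ) ≤ ∑ p ∈ P, coef b R q p * pe ρ p σ := by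
  rw [sum_coef_mul b R P _ q hq h3 h2]
  by_cases ht : q.2.1.1 = 0 ∧ q.1 0 = (b : ℤ)
  · rw [if_pos ht]
    exact pe_twist_top_le ρ hρu hb hR k₀ σ hqT ht
  · rw [if_neg ht, add_zero]
    have he : pe ρ q (topTwist b (comb b R k₀ σ) σ) = pe ρ q σ := energy_topTwist_of_not_topFace ρ b _ σ q ht
    rw [he]
    linarith [pe_nonneg ρ hρu q σ]

/-- Total coefficient mass of one plaquette: `2`, plus `≤ 128 R²` for a top-face plaquette. -/
theorem sum_coef_le {b n R : ℕ} (hR : (2 * n + 1) * b ≤ R) (P : Finset (ZdPlaquette 4)) {q : ZdPlaquette 4}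
    (hqT : q ∈ plaquettesTouching (rowRegion b n)) (hq : q ∈ P)
    (h3 : ∀ k ∈ Finset.range (combLen R (q.1 + Pi.single 0 1) 3), hp3 b R (q.1 + Pi.single 0 1) q.2.1.2 k ∈ P)
    (h2 : ∀ k ∈ Finset.range (combLen R (q.1 + Pi.single 0 1) 2), hp2 b R (q.1 + Pi.single 0 1) k ∈ P) :
    ∑ p ∈ P, coef b R q p ≤ 2 + if q.2.1.1 = 0 ∧ q.1 0 = (b : ℤ) then 128 * (R : ℝ) ^ 2 else 0 := by
  have h := sum_coef_mul b R P (fun _ => (1 : ℝ)) q hq h3 h2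
  simp only [mul_one, Finset.sum_const, Finset.card_range, nsmul_eq_mul] at h
  rw [h]
  by_cases ht : q.2.1.1 = 0 ∧ q.1 0 = (b : ℤ)
  · rw [if_pos ht, if_pos ht]
    have hbox := mem_topBox_of_touching hqT ht.2
    rw [topBox, Fintype.mem_piFinset] at hbox
    have hsp : ∀ l : Fin 4, l ≠ 0 → q.1 l ≤ (2 * (n : ℤ) + 1) * b - 1 := fun l hl => by
      have h := hbox l
      rw [if_neg hl, Finset.mem_Icc] at h
      exact h.2
    have hyl : ∀ l : Fin 4, l ≠ 0 → ((q.1 + Pi.single (0 : Fin 4) (1 : ℤ) : Site 4)) l = q.1 l := fun l hl => by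
      rw [Pi.add_apply, Pi.single_apply, if_neg hl, add_zero]
    have hRz : (((2 * n + 1) * b : ℕ) : ℤ) ≤ (R : ℤ) := by exact_mod_cast hR
    push_cast at hRz
    have hle : ∀ l : Fin 4, l ≠ 0 → ((q.1 + Pi.single (0 : Fin 4) (1 : ℤ) : Site 4)) l ≤ (R : ℤ) := fun l hl => by
      rw [hyl l hl]; linarith [hsp l hl]
    have hn3 : (combLen R (q.1 + Pi.single 0 1) 3 : ℝ) ≤ 2 * R := by
      exact_mod_cast combLen_le (hle 3 (by decide))
    have hn2 : (combLen R (q.1 + Pi.single 0 1) 2 : ℝ) ≤ 2 * R := by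
      exact_mod_cast combLen_le (hle 2 (by decide))
    have hR0 : (0 : ℝ) ≤ (R : ℝ) := Nat.cast_nonneg R
    have hm := mul_le_mul_of_nonneg_left (add_le_add hn3 hn2) (by positivity : (0 : ℝ) ≤ 32 * (R : ℝ))
    nlinarith [hn3, hn2, hR0, hm]
  · rw [if_neg ht, if_neg ht]

/-- The bounding box of the base points of ALL plaquettes touching `Λ = rowRegion b n`. -/
def bigBox (b n : ℕ) : Finset (Site 4) :=
  Fintype.piFinset fun i : Fin 4 =>
    if i = 0 then Finset.Icc (0 : ℤ) b else Finset.Icc (-(2 * (n : ℤ) * b) - 1) ((2 * (n : ℤ) + 1) * b - 1)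

theorem card_bigBox (b n : ℕ) : (bigBox b n).card = (b + 1) * ((4 * n + 1) * b + 1) ^ 3 := by
  rw [bigBox, Fintype.card_piFinset, Fin.prod_univ_four, if_pos rfl, if_neg (show (1 : Fin 4) ≠ 0 by decide),
    if_neg (show (2 : Fin 4) ≠ 0 by decide), if_neg (show (3 : Fin 4) ≠ 0 by decide), Int.card_Icc, Int.card_Icc]
  have h : (2 * (n : ℤ) + 1) * b - 1 + 1 - (-(2 * (n : ℤ) * b) - 1) = (((4 * n + 1) * b + 1 : ℕ) : ℤ) := by
    push_cast; ring
  have h0 : (b : ℤ) + 1 - 0 = ((b + 1 : ℕ) : ℤ) := by push_cast; ring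
  rw [h, h0, Int.toNat_natCast, Int.toNat_natCast]
  ring

theorem mem_bigBox_of_touching {b n : ℕ} {q : ZdPlaquette 4} (hq : q ∈ plaquettesTouching (rowRegion b n)) :
    q.1 ∈ bigBox b n := by
  rw [mem_plaquettesTouching_iff] at hq
  obtain ⟨e, he⟩ := hq
  rw [Finset.mem_inter] at he
  obtain ⟨he1, he2⟩ := he
  rw [bigBox, Fintype.mem_piFinset]
  have hbox := box_of_mem_rowRegion he2
  intro i
  by_cases hi : i = 0
  · subst hi
    rw [if_pos rfl, Finset.mem_Icc]
    have hs := hbox.1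
    simp only [plaquetteEdges, Finset.mem_insert, Finset.mem_singleton] at he1
    rcases he1 with rfl | rfl | rfl | rfl
    · dsimp only at hs
      constructor <;> linarith [hs.1, hs.2]
    · dsimp only at hs
      rw [Pi.add_apply, Pi.single_apply] at hs
      split_ifs at hs <;> constructor <;> linarith [hs.1, hs.2]
    · dsimp only at hs
      rw [Pi.add_apply, Pi.single_apply] at hs
      split_ifs at hs <;> constructor <;> linarith [hs.1, hs.2]
    · dsimp only at hs
      constructor <;> linarith [hs.1, hs.2]
  · rw [if_neg hi, Finset.mem_Icc]
    have hs := hbox.2 i hi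
    simp only [plaquetteEdges, Finset.mem_insert, Finset.mem_singleton] at he1
    rcases he1 with rfl | rfl | rfl | rfl
    · dsimp only at hs
      constructor <;> linarith [hs.1, hs.2]
    · dsimp only at hs
      rw [Pi.add_apply, Pi.single_apply] at hs
      split_ifs at hs <;> constructor <;> linarith [hs.1, hs.2]
    · dsimp only at hs
      rw [Pi.add_apply, Pi.single_apply] at hs
      split_ifs at hs <;> constructor <;> linarith [hs.1, hs.2]
    · dsimp only at hs
      constructor <;> linarith [hs.1, hs.2]

/-- `#plaquettesTouching (rowRegion b n) ≤ 6 (b+1) ((4n+1)b+1)³`. -/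
theorem card_touching_rowRegion_le (b n : ℕ) :
    (plaquettesTouching (rowRegion b n)).card ≤ 6 * ((b + 1) * ((4 * n + 1) * b + 1) ^ 3) := by
  have hsub : plaquettesTouching (rowRegion b n) ⊆
      bigBox b n ×ˢ (Finset.univ : Finset {p : Fin 4 × Fin 4 // p.1 < p.2}) := fun q hq =>
    Finset.mem_product.2 ⟨mem_bigBox_of_touching hq, Finset.mem_univ _⟩
  refine (Finset.card_le_card hsub).trans ?_
  rw [Finset.card_product, card_bigBox, Finset.card_univ, card_orientations, mul_comm]

/-- `#(top-height plaquettes touching Λ) ≤ 6 ((4n+1)b+1)³`, numeric form. -/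
theorem card_touching_top_le (b n : ℕ) :
    ((plaquettesTouching (rowRegion b n)).filter (fun q => q.2.1.1 = 0 ∧ q.1 0 = (b : ℤ))).card ≤
      6 * ((4 * n + 1) * b + 1) ^ 3 := by
  refine le_trans (Finset.card_le_card ?_) ((card_touching_height_eq_le b n).trans_eq (by rw [card_orientations]))
  intro q hq
  rw [Finset.mem_filter] at hq ⊢
  exact ⟨hq.1, hq.2.2⟩

/-- **R1d′ — THE ROW-FLOOR STUB OVER TREE TERMS (PROVED).**  For unitary `ρ` and every `n, k₀` there is `C > 0` such that for
every `b ≥ 1` a FIXED finite family of plaquettes `P` with nonnegative weights of total mass `≤ C b⁵` dominates, configuration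
by configuration, the boundary Wilson action over `Λ = rowRegion b n` of the TWISTED configuration
`σ' = twistΦ_b(comb_{b,(2n+2)b+1,k₀}) σ` by the weighted plaquette energies OF `σ`.  Since the row-floor file proves
`refConfig b n k₀ σ = twistΦ b (comb b ((2n+2)b+1) k₀) σ` (`refConfig_eq_twistΦ`), this IS its stub R1d
`refAction_le_weighted` up to that rewrite. -/
theorem twistAction_le_weighted (hρu : ∀ g, ρ g ∈ Matrix.unitaryGroup (Fin N) ℂ) (n : ℕ) (k₀ : G) :
    ∃ C : ℝ, 0 < C ∧ ∀ b : ℕ, 1 ≤ b →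
      ∃ (P : Finset (ZdPlaquette 4)) (w : ZdPlaquette 4 → ℝ), (∀ q, 0 ≤ w q) ∧
        ∑ q ∈ P, w q ≤ C * (b : ℝ) ^ 5 ∧
        ∀ σ : LGConfig 4 G,
          wilsonBoundaryAction ρ (rowRegion b n) (twistΦ b (comb b ((2 * n + 2) * b + 1) k₀) σ) ≤
            ∑ q ∈ P, w q * ((N : ℝ) - plaquetteObs ρ q.1 q.2.1.1 q.2.1.2 σ) := by
  refine ⟨24 * (4 * (n : ℝ) + 2) ^ 3 + 768 * (4 * (n : ℝ) + 2) ^ 3 * (2 * (n : ℝ) + 3) ^ 2, by positivity,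
    fun b hb => ?_⟩
  -- the data
  set R : ℕ := (2 * n + 2) * b + 1 with hRdef
  have hR : (2 * n + 1) * b ≤ R := by rw [hRdef]; nlinarith
  let T : Finset (ZdPlaquette 4) := plaquettesTouching (rowRegion b n)
  let H : ZdPlaquette 4 → Finset (ZdPlaquette 4) := fun q =>
    (Finset.range (combLen R (q.1 + Pi.single 0 1) 3)).image (hp3 b R (q.1 + Pi.single 0 1) q.2.1.2) ∪
      (Finset.range (combLen R (q.1 + Pi.single 0 1) 2)).image (hp2 b R (q.1 + Pi.single 0 1))
  let P : Finset (ZdPlaquette 4) := T ∪ T.biUnion H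
  have hTP : ∀ q ∈ T, q ∈ P := fun q hq => Finset.mem_union_left _ hq
  have h3P : ∀ q ∈ T, ∀ k ∈ Finset.range (combLen R (q.1 + Pi.single 0 1) 3),
      hp3 b R (q.1 + Pi.single 0 1) q.2.1.2 k ∈ P := fun q hq k hk =>
    Finset.mem_union_right _ (Finset.mem_biUnion.2 ⟨q, hq, Finset.mem_union_left _ (Finset.mem_image_of_mem _ hk)⟩)
  have h2P : ∀ q ∈ T, ∀ k ∈ Finset.range (combLen R (q.1 + Pi.single 0 1) 2),
      hp2 b R (q.1 + Pi.single 0 1) k ∈ P := fun q hq k hk =>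
    Finset.mem_union_right _ (Finset.mem_biUnion.2 ⟨q, hq, Finset.mem_union_right _ (Finset.mem_image_of_mem _ hk)⟩)
  refine ⟨P, fun p => ∑ q ∈ T, coef b R q p, fun p => Finset.sum_nonneg fun q _ => coef_nonneg b R q p, ?_, ?_⟩
  · -- total weight
    rw [Finset.sum_comm]
    have hq : ∀ q ∈ T, ∑ p ∈ P, coef b R q p ≤ 2 + if q.2.1.1 = 0 ∧ q.1 0 = (b : ℤ) then 128 * (R : ℝ) ^ 2 else 0 :=
      fun q hqT => sum_coef_le hR P hqT (hTP q hqT) (h3P q hqT) (h2P q hqT)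
    refine (Finset.sum_le_sum hq).trans ?_
    rw [Finset.sum_add_distrib, Finset.sum_const, nsmul_eq_mul, ← Finset.sum_filter, Finset.sum_const, nsmul_eq_mul]
    have hT : (T.card : ℝ) ≤ 6 * (((b : ℝ) + 1) * ((4 * n + 1) * b + 1) ^ 3) := by
      exact_mod_cast card_touching_rowRegion_le b n
    have hTt : ((T.filter (fun q => q.2.1.1 = 0 ∧ q.1 0 = (b : ℤ))).card : ℝ) ≤ 6 * ((4 * (n : ℝ) + 1) * b + 1) ^ 3 := by
      exact_mod_cast card_touching_top_le b n
    have hb1 : (1 : ℝ) ≤ (b : ℝ) := by exact_mod_cast hb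
    have hRr : (R : ℝ) = (2 * n + 2) * b + 1 := by rw [hRdef]; push_cast; ring
    have hL : (4 * (n : ℝ) + 1) * b + 1 ≤ (4 * (n : ℝ) + 2) * b := by nlinarith
    have hRle : (R : ℝ) ≤ (2 * (n : ℝ) + 3) * b := by rw [hRr]; nlinarith
    have hn0 : (0 : ℝ) ≤ (n : ℝ) := Nat.cast_nonneg n
    have hL0 : (0 : ℝ) ≤ (4 * (n : ℝ) + 1) * b + 1 := by positivity
    have hR0 : (0 : ℝ) ≤ (R : ℝ) := Nat.cast_nonneg R
    have hb4 : (b : ℝ) ^ 4 ≤ (b : ℝ) ^ 5 := pow_le_pow_right₀ hb1 (by norm_num)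
    calc (T.card : ℝ) * 2 + ((T.filter (fun q => q.2.1.1 = 0 ∧ q.1 0 = (b : ℤ))).card : ℝ) * (128 * (R : ℝ) ^ 2)
        ≤ 6 * (((b : ℝ) + 1) * ((4 * n + 1) * b + 1) ^ 3) * 2 +
            6 * ((4 * (n : ℝ) + 1) * b + 1) ^ 3 * (128 * (R : ℝ) ^ 2) := by gcongr
      _ ≤ 6 * ((2 * (b : ℝ)) * ((4 * (n : ℝ) + 2) * b) ^ 3) * 2 +
            6 * ((4 * (n : ℝ) + 2) * b) ^ 3 * (128 * ((2 * (n : ℝ) + 3) * b) ^ 2) := by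
          gcongr
          · linarith
      _ = 24 * (4 * (n : ℝ) + 2) ^ 3 * (b : ℝ) ^ 4 + 768 * (4 * (n : ℝ) + 2) ^ 3 * (2 * (n : ℝ) + 3) ^ 2 * (b : ℝ) ^ 5 := by
          ring
      _ ≤ 24 * (4 * (n : ℝ) + 2) ^ 3 * (b : ℝ) ^ 5 + 768 * (4 * (n : ℝ) + 2) ^ 3 * (2 * (n : ℝ) + 3) ^ 2 * (b : ℝ) ^ 5 := by
          gcongr
      _ = _ := by ring
  · -- domination
    intro σ
    rw [twistΦ, wilsonBoundaryAction_eq_sum_pe]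
    have hq : ∀ q ∈ T, pe ρ q (topTwist b (comb b R k₀ σ) σ) ≤ ∑ p ∈ P, coef b R q p * pe ρ p σ := fun q hqT =>
      pe_twist_le_sum_coef ρ hρu hb hR k₀ σ P hqT (hTP q hqT) (h3P q hqT) (h2P q hqT)
    refine (Finset.sum_le_sum hq).trans_eq ?_
    rw [Finset.sum_comm]
    refine Finset.sum_congr rfl fun p _ => ?_
    rw [Finset.sum_mul]
    rfl

end Assembly

end Summit.QuantumFields.YangMills.Cruxes.IR.CruxIdea2g7Hairpin

end
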